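import Summits.QuantumFields.YangMills.Theorems.IR.EsPolymerGasReductionK
import Summits.QuantumFields.YangMills.Theorems.IR.EsPolymerESMeasures
import Summits.QuantumFields.YangMills.Theorems.IR.ShellMaxCorrTorusCount
import Mathlib.Combinatorics.SimpleGraph.Paths

/-!
# Crux `IR` (item stmt-QuantumFields-19354) — line «es-polymer-decoupling», reshaped engine, input (b): THE PEIERLS TAIL OF A
POLYMER NEAR BOTH BLOCKS

Helper module for item `stmt-QuantumFields-19354` (`--supports … --as helper`; it closes nothing; lead prover
ym-ir-line-mxc-p1 g2).  For an abstract representation (`μ = ∑_Γ ν_Γ`, `ν_Γ = 0` off compatible families, clause (P)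
`ν_Γ(1) = Z⁻¹ ∏_{γ∈Γ} act γ` with `0 ≤ act γ ≤ p^{#γ}`), the gas-probability of the bad event of
`abs_cov_sub_gasCov_le_nearFamily` (`Theorems/IR/EsPolymerGasReductionK.lean`) — some polymer is near BOTH radius-`k`
blocks about `c_A`, `c_B` — is at most `2 (2k+3)⁴ (√p)^{(cellDist c_A c_B − (2k+2))/6 + 2}` once `(13⁴+1)² √p ≤ 1/2`
(`sum_mass_not_disjoint_nearFamily_le_pow`).  Inputs: a polymer (steps of cell distance `≤ 6`) has diameter
`≤ 6 (#γ − 1)` (`cellDist_le_mul_card_sub_one`, a shortest-path argument in Mathlib's `SimpleGraph`), a cell ball of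
radius `r` has `≤ (2r+1)⁴` cells (`card_filter_cellDist_le`, from `card_filter_torusNorm_le`), Peierls `∑_{Γ∋γ} ν_Γ(1) ≤ act γ`
(`sum_mass_filter_mem_le_act`) and the lattice-animal bound `PolymerGasGeometric.sum_pow_card_le_of_connected`.

HONEST FRAMING: bookkeeping for ONE input of an OPEN engine stub of a CONDITIONAL rung line; no clustering, no polymer
representation at weak coupling and no mass gap is proved here. -/

set_option autoImplicit false

noncomputable section

open MeasureTheory Finset Function
open Literature.MathematicalPhysics.QuantumFieldTheory
open Literature.Probability.LatticeModels (IsRConnected sum_pow_card_le_of_connected)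

namespace Summit.QuantumFields.YangMills.Cruxes.IR.EsPolymer

/-! ## §1 Diameter of a connected cell set -/

/-- **A cell set connected by steps of cell distance `≤ r` has diameter `≤ r (#γ − 1)`** (a shortest chain is a path,
hence has fewer steps than `γ` has cells). -/
theorem cellDist_le_mul_card_sub_one {q r : ℕ} {γ : Finset (Cell q)}
    (hconn : ∀ c ∈ γ, ∀ c' ∈ γ, Relation.ReflTransGen (fun x y => x ∈ γ ∧ y ∈ γ ∧ cellDist x y ≤ r) c c')
    {c c' : Cell q} (hc : c ∈ γ) (hc' : c' ∈ γ) : cellDist c c' ≤ r * (γ.card - 1) := by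
  classical
  -- the graph on the cells of `γ`
  set Gr : SimpleGraph {x // x ∈ γ} := SimpleGraph.fromRel fun x y => cellDist x.1 y.1 ≤ r with hGr
  -- distance along a walk
  have hwalk : ∀ (u v : {x // x ∈ γ}) (w : Gr.Walk u v), cellDist u.1 v.1 ≤ r * w.length := by
    intro u v w
    induction w with
    | nil => simp [cellDist_self]
    | @cons a b _ hab w' ih =>
      rw [SimpleGraph.Walk.length_cons]
      have hab' : cellDist a.1 b.1 ≤ r := by
        rcases (SimpleGraph.fromRel_adj _ _ _).1 hab with ⟨-, h | h⟩
        · exact h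
        · rwa [cellDist_comm] at h
      calc cellDist a.1 _ ≤ cellDist a.1 b.1 + cellDist b.1 _ := cellDist_triangle _ _ _
        _ ≤ r + r * w'.length := add_le_add hab' ih
        _ = r * (w'.length + 1) := by ring
  -- reachability from the chain
  have hreach : ∀ a b : Cell q, Relation.ReflTransGen (fun x y => x ∈ γ ∧ y ∈ γ ∧ cellDist x y ≤ r) a b →
      ∀ (ha : a ∈ γ) (hb : b ∈ γ), Gr.Reachable ⟨a, ha⟩ ⟨b, hb⟩ := by
    intro a b h
    induction h with
    | refl => intro ha hb; exact SimpleGraph.Reachable.refl _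
    | @tail x y _ hxy ih =>
      intro ha hy
      refine (ih ha hxy.1).trans ?_
      by_cases hne : x = y
      · subst hne; exact SimpleGraph.Reachable.refl _
      · exact SimpleGraph.Adj.reachable ((SimpleGraph.fromRel_adj _ _ _).2
          ⟨fun h => hne (congrArg Subtype.val h), Or.inl hxy.2.2⟩)
  obtain ⟨w⟩ := hreach c c' (hconn c hc c' hc') hc hc'
  have hlen : w.bypass.length < γ.card := by
    have := (SimpleGraph.Walk.bypass_isPath w).length_lt
    rwa [Fintype.card_coe] at this
  calc cellDist c c' ≤ r * w.bypass.length := hwalk _ _ w.bypass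
    _ ≤ r * (γ.card - 1) := Nat.mul_le_mul_left _ (by omega)

/-- A polymer (steps of cell distance `≤ 6`) containing cells within `k+1` of `c_A` and of `c_B` has at least
`(cellDist c_A c_B − (2k+2))/6 + 1` cells. -/
theorem card_ge_of_isPolymer_near_both {q k : ℕ} {γ : Finset (Cell q)} (hγ : IsPolymer γ) {cA cB c₁ c₂ : Cell q}
    (h₁ : c₁ ∈ γ) (h₁d : cellDist cA c₁ ≤ k + 1) (h₂ : c₂ ∈ γ) (h₂d : cellDist cB c₂ ≤ k + 1) :
    (cellDist cA cB - (2 * k + 2)) / 6 + 1 ≤ γ.card := by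
  have hdiam := cellDist_le_mul_card_sub_one hγ.2 h₁ h₂
  have ht1 := cellDist_triangle cA c₁ c₂
  have ht2 := cellDist_triangle cA c₂ cB
  rw [cellDist_comm cB c₂] at h₂d
  have hpos : 1 ≤ γ.card := card_pos.2 ⟨c₁, h₁⟩
  omega

/-! ## §2 Counting cells in a ball -/

/-- A cell ball of radius `r` has at most `(2r+1)⁴` cells. -/
theorem card_filter_cellDist_le {q : ℕ} [NeZero q] (c : Cell q) (r : ℕ) :
    (Finset.univ.filter fun c' : Cell q => cellDist c c' ≤ r).card ≤ (2 * r + 1) ^ 4 := by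
  classical
  refine le_trans ?_ (ShellMaxCorr.TorusTilt.card_filter_torusNorm_le (d := 4) (L := q) r)
  refine card_le_card_of_injOn (fun c' => cellEquiv c - cellEquiv c') (fun c' hc' => ?_) fun x _ y _ hxy => ?_
  · rw [mem_coe, mem_filter] at hc' ⊢
    exact ⟨mem_univ _, by rw [← cellDist_eq_torusNorm]; exact hc'.2⟩
  · exact cellEquiv.injective (sub_right_injective hxy)

/-! ## §3 The Peierls tail -/

section Tail

variable {G : Type} [MeasurableSpace G] {N q : ℕ}
  (ν : Finset (Finset (Cell q)) → Measure (GaugeConfig 4 N G)) (μ : Measure (GaugeConfig 4 N G))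
  [IsProbabilityMeasure μ] (hsum : Finset.univ.sum ν = μ) (hν0 : ∀ Γ, ¬ Compatible Γ → ν Γ = 0)

include hsum hν0

omit [IsProbabilityMeasure μ] hsum in
open Classical in
/-- Families containing a NON-polymer carry no mass. -/
theorem sum_mass_filter_mem_eq_zero_of_not_isPolymer {γ : Finset (Cell q)} (hγ : ¬ IsPolymer γ) :
    ∑ Γ ∈ Finset.univ.filter (fun Γ => γ ∈ Γ), (ν Γ Set.univ).toReal = 0 := by
  refine sum_eq_zero fun Γ hΓ => ?_
  have hmem : γ ∈ Γ := (mem_filter.1 hΓ).2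
  have hnc : ¬ Compatible Γ := fun h => hγ (h.1 γ hmem)
  rw [hν0 Γ hnc]; simp

open Classical in
/-- **The Peierls tail of a polymer near both blocks.**  With clause (P) (`0 ≤ act γ ≤ p^{#γ}`,
`ν_Γ(1) = Z⁻¹ ∏ act` on compatible families) and `(13⁴+1)² √p ≤ 1/2`: the gas-probability that the near families of the
radius-`k` blocks about `c_A`, `c_B` intersect is at most `2 (2k+3)⁴ (√p)^{(cellDist c_A c_B − (2k+2))/6 + 2}`. -/
theorem sum_mass_not_disjoint_nearFamily_le_pow [NeZero q] (act : Finset (Cell q) → ℝ) (hact : ∀ γ, 0 ≤ act γ)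
    {Z p : ℝ} (hmass : ∀ Γ, Compatible Γ → (ν Γ Set.univ).toReal = Z⁻¹ * ∏ γ ∈ Γ, act γ) (hp : 0 ≤ p)
    (hactp : ∀ γ, act γ ≤ p ^ γ.card) (hsmall : ((13 : ℝ) ^ 4 + 1) ^ 2 * Real.sqrt p ≤ 1 / 2) (k : ℕ)
    (cA cB : Cell q) :
    ∑ Γ ∈ Finset.univ.filter (fun Γ => Compatible Γ ∧ ¬ Disjoint (nearFamily Γ cA k) (nearFamily Γ cB k)),
        (ν Γ Set.univ).toReal ≤
      2 * ((2 * k + 3 : ℕ) : ℝ) ^ 4 * Real.sqrt p ^ ((cellDist cA cB - (2 * k + 2)) / 6 + 2) := by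
  set t : ℝ := Real.sqrt p with ht
  have ht0 : 0 ≤ t := Real.sqrt_nonneg p
  have ht1 : t ≤ 1 := by nlinarith [hsmall, ht0]
  have htp : t ^ 2 = p := Real.sq_sqrt hp
  set e : ℕ := (cellDist cA cB - (2 * k + 2)) / 6 with he
  -- the doubly-near polymers
  set D : Finset (Finset (Cell q)) := Finset.univ.filter fun γ : Finset (Cell q) =>
    (∃ c' ∈ γ, cellDist cA c' ≤ k + 1) ∧ ∃ c' ∈ γ, cellDist cB c' ≤ k + 1 with hD
  set D' : Finset (Finset (Cell q)) := D.filter fun γ => IsPolymer γ with hD'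
  -- step 1: union bound + Peierls, non-polymers dropped
  have h1 : ∑ Γ ∈ Finset.univ.filter (fun Γ => Compatible Γ ∧ ¬ Disjoint (nearFamily Γ cA k) (nearFamily Γ cB k)),
      (ν Γ Set.univ).toReal ≤ ∑ γ ∈ D', p ^ γ.card := by
    refine (sum_mass_not_disjoint_nearFamily_le ν k cA cB).trans ?_
    rw [← sum_filter_add_sum_filter_not D fun γ => IsPolymer γ]
    have hz : ∑ γ ∈ D.filter (fun γ => ¬ IsPolymer γ), ∑ Γ ∈ Finset.univ.filter (fun Γ => γ ∈ Γ),
        (ν Γ Set.univ).toReal = 0 :=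
      sum_eq_zero fun γ hγ => sum_mass_filter_mem_eq_zero_of_not_isPolymer ν hν0 (mem_filter.1 hγ).2
    rw [hz, add_zero]
    exact sum_le_sum fun γ _ => (sum_mass_filter_mem_le_act ν μ hsum hν0 act hact hmass γ).trans (hactp γ)
  -- step 2: size of a doubly-near polymer, `p^{#γ} ≤ t^{e+1} t^{#γ}`
  have h2 : ∀ γ ∈ D', p ^ γ.card ≤ t ^ (e + 1) * t ^ γ.card := by
    intro γ hγ
    obtain ⟨hγD, hγP⟩ := mem_filter.1 hγ
    obtain ⟨-, ⟨c₁, h₁, h₁d⟩, ⟨c₂, h₂, h₂d⟩⟩ := mem_filter.1 hγD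
    have hcard : e + 1 ≤ γ.card := card_ge_of_isPolymer_near_both hγP h₁ h₁d h₂ h₂d
    rw [← htp, ← pow_mul, ← pow_add]
    exact pow_le_pow_of_le_one ht0 ht1 (by omega)
  -- step 3: every doubly-near polymer contains a cell of the ball of radius `k+1` about `c_A`; animal bound there
  set ball : Finset (Cell q) := Finset.univ.filter fun c' : Cell q => cellDist cA c' ≤ k + 1 with hball
  have h3 : ∑ γ ∈ D', t ^ γ.card ≤ ∑ c₁ ∈ ball, ∑ γ ∈ D'.filter (fun γ => c₁ ∈ γ), t ^ γ.card := by
    have hR : ∑ c₁ ∈ ball, ∑ γ ∈ D'.filter (fun γ => c₁ ∈ γ), t ^ γ.card =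
        ∑ γ ∈ D', ∑ c₁ ∈ ball, if c₁ ∈ γ then t ^ γ.card else 0 := by
      simp_rw [sum_filter]; rw [sum_comm]
    rw [hR]
    refine sum_le_sum fun γ hγ => ?_
    obtain ⟨-, ⟨c₁, h₁, h₁d⟩, -⟩ := mem_filter.1 (mem_filter.1 hγ).1
    have hc₁ : c₁ ∈ ball := mem_filter.2 ⟨mem_univ _, h₁d⟩
    have h0 : ∀ c ∈ ball, 0 ≤ (if c ∈ γ then t ^ γ.card else 0) := fun c _ => by
      split_ifs
      · exact pow_nonneg ht0 _
      · exact le_rfl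
    calc t ^ γ.card = if c₁ ∈ γ then t ^ γ.card else 0 := by rw [if_pos h₁]
      _ ≤ _ := single_le_sum (f := fun c => if c ∈ γ then t ^ γ.card else 0) h0 hc₁
  have h4 : ∀ c₁ : Cell q, ∑ γ ∈ D'.filter (fun γ => c₁ ∈ γ), t ^ γ.card ≤ 2 * t := by
    intro c₁
    refine sum_pow_card_le_of_connected (R := fun x y : Cell q => cellDist x y ≤ 6)
      (nbr := fun x => Finset.univ.filter fun y : Cell q => cellDist x y ≤ 6) (Δ := 13 ^ 4)
      (fun x y h => by rwa [cellDist_comm]) (fun x => ?_) (fun x y h => mem_filter.2 ⟨mem_univ _, h⟩) ht0 ?_ c₁ _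
      fun γ hγ => ?_
    · exact (card_filter_cellDist_le x 6).trans (by norm_num)
    · push_cast; linarith [hsmall]
    · obtain ⟨hγD', hc₁⟩ := mem_filter.1 hγ
      have hP : IsPolymer γ := (mem_filter.1 hγD').2
      exact ⟨hc₁, hP.1, fun c hc c' hc' => Relation.ReflTransGen.mono
        (fun x y (h : x ∈ γ ∧ y ∈ γ ∧ cellDist x y ≤ 6) => (⟨h.2.2, h.1, h.2.1⟩ : cellDist x y ≤ 6 ∧ x ∈ γ ∧ y ∈ γ))
        _ _ (hP.2 c hc c' hc')⟩
  have hballcard : (ball.card : ℝ) ≤ ((2 * k + 3 : ℕ) : ℝ) ^ 4 := by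
    have := card_filter_cellDist_le cA (k + 1)
    have h' : 2 * (k + 1) + 1 = 2 * k + 3 := by ring
    rw [h'] at this
    exact_mod_cast this
  -- assembly
  calc ∑ Γ ∈ Finset.univ.filter (fun Γ => Compatible Γ ∧ ¬ Disjoint (nearFamily Γ cA k) (nearFamily Γ cB k)),
        (ν Γ Set.univ).toReal
      ≤ ∑ γ ∈ D', p ^ γ.card := h1
    _ ≤ ∑ γ ∈ D', t ^ (e + 1) * t ^ γ.card := sum_le_sum h2
    _ = t ^ (e + 1) * ∑ γ ∈ D', t ^ γ.card := by rw [mul_sum]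
    _ ≤ t ^ (e + 1) * ∑ c₁ ∈ ball, ∑ γ ∈ D'.filter (fun γ => c₁ ∈ γ), t ^ γ.card :=
        mul_le_mul_of_nonneg_left h3 (pow_nonneg ht0 _)
    _ ≤ t ^ (e + 1) * ∑ _c₁ ∈ ball, 2 * t := mul_le_mul_of_nonneg_left (sum_le_sum fun c₁ _ => h4 c₁) (pow_nonneg ht0 _)
    _ = t ^ (e + 1) * (ball.card * (2 * t)) := by rw [sum_const, nsmul_eq_mul]
    _ ≤ t ^ (e + 1) * (((2 * k + 3 : ℕ) : ℝ) ^ 4 * (2 * t)) :=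
        mul_le_mul_of_nonneg_left (mul_le_mul_of_nonneg_right hballcard (by positivity)) (pow_nonneg ht0 _)
    _ = 2 * ((2 * k + 3 : ℕ) : ℝ) ^ 4 * t ^ (e + 2) := by ring

end Tail

end Summit.QuantumFields.YangMills.Cruxes.IR.EsPolymer

end
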